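import Literature.AnabelianGeometry.AbsoluteAnabelian.AutHolomorphicSpacesTransportProofs
import HarnessLib

/-!
# Disc pictures of self-homeomorphisms of an Aut-holomorphic disc (PROOF-ONLY support for Prop. 2.2 (ii))

For a Riemann surface `Y` with a biholomorphic homeomorphism `e : Y ≃ₜ unitDiscOpens`, every
self-homeomorphism `ψ` of `Y` has a *disc picture*: the total function
`Function.extend Subtype.val (Subtype.val ∘ (e.symm.trans (ψ.trans e))) 0 : ℂ → ℂ`, i.e.
`z ↦ e (ψ (e⁻¹ z))` on the ball.  This file records the dictionary used by the discharge of
[AbsTopIII] Prop. 2.2 (ii) (`DiscRCHolAutClosedCommTerminal`): pictures of products / inverses /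
powers, injectivity, biholomorphic `ψ` ↔ holomorphic automorphism picture, and the realisation of
disc automorphisms (the anti-holomorphic half of the dictionary is in
`AutHolomorphicSpacesDiscPictureRCProofs`).

[cite: MochizukiAbsTopIII2015, Proposition 2.2 (ii) p.52]
-/

noncomputable section

namespace Literature.AnabelianGeometry.AbsoluteAnabelian

universe u

open _root_.TopologicalSpace _root_.Topology _root_.Set _root_.Metric _root_.Function _root_.Filter
open scoped _root_.Manifold _root_.ContDiff ComplexConjugate
open Literature.Analysis.Complex

/-! ### Pictures: algebra -/

section PictureAlgebra

variable {Y : Type u} [TopologicalSpace Y]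

/-- The disc picture on the disc: `pic ψ` in `e`-coordinates. [cite: MochizukiAbsTopIII2015, Proposition 2.2 (ii) p.52] -/
theorem pic_apply (e : Y ≃ₜ unitDiscOpens) (ψ : Y ≃ₜ Y) (x : unitDiscOpens) :
    Function.extend Subtype.val (Subtype.val ∘ (e.symm.trans (ψ.trans e))) (fun _ => (0 : ℂ)) x =
      (e (ψ (e.symm x)) : ℂ) :=
  extend_apply_coe _ _ x

/-- The disc picture at a point of the ball. [cite: MochizukiAbsTopIII2015, Proposition 2.2 (ii) p.52] -/
theorem pic_apply_of_mem (e : Y ≃ₜ unitDiscOpens) (ψ : Y ≃ₜ Y) {z : ℂ} (hz : z ∈ ball (0 : ℂ) 1) :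
    Function.extend Subtype.val (Subtype.val ∘ (e.symm.trans (ψ.trans e))) (fun _ => (0 : ℂ)) z =
      (e (ψ (e.symm ⟨z, hz⟩)) : ℂ) :=
  pic_apply e ψ ⟨z, hz⟩

/-- Picture of a product: `pic (ψ₁ ψ₂) = pic ψ₁ ∘ pic ψ₂` on the ball.
[cite: MochizukiAbsTopIII2015, Proposition 2.2 (ii) p.52] -/
theorem pic_mul (e : Y ≃ₜ unitDiscOpens) (ψ₁ ψ₂ : Y ≃ₜ Y) {z : ℂ} (hz : z ∈ ball (0 : ℂ) 1) :
    Function.extend Subtype.val (Subtype.val ∘ (e.symm.trans ((ψ₁ * ψ₂).trans e))) (fun _ => (0 : ℂ)) z =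
      Function.extend Subtype.val (Subtype.val ∘ (e.symm.trans (ψ₁.trans e))) (fun _ => (0 : ℂ))
        (Function.extend Subtype.val (Subtype.val ∘ (e.symm.trans (ψ₂.trans e))) (fun _ => (0 : ℂ)) z) := by
  rw [pic_apply_of_mem e _ hz, pic_apply_of_mem e ψ₂ hz, pic_apply e ψ₁]
  simp [Homeomorph.mul_apply]

/-- Picture of the identity. [cite: MochizukiAbsTopIII2015, Proposition 2.2 (ii) p.52] -/
theorem pic_one (e : Y ≃ₜ unitDiscOpens) {z : ℂ} (hz : z ∈ ball (0 : ℂ) 1) :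
    Function.extend Subtype.val (Subtype.val ∘ (e.symm.trans ((1 : Y ≃ₜ Y).trans e))) (fun _ => (0 : ℂ)) z
      = z := by
  rw [pic_apply_of_mem e _ hz]
  show ((e (e.symm ⟨z, hz⟩) : unitDiscOpens) : ℂ) = z
  rw [e.apply_symm_apply]

/-- Picture of the inverse is a left inverse on the ball. [cite: MochizukiAbsTopIII2015, Proposition 2.2 (ii) p.52] -/
theorem pic_inv_apply (e : Y ≃ₜ unitDiscOpens) (ψ : Y ≃ₜ Y) {z : ℂ} (hz : z ∈ ball (0 : ℂ) 1) :
    Function.extend Subtype.val (Subtype.val ∘ (e.symm.trans (ψ⁻¹.trans e))) (fun _ => (0 : ℂ))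
      (Function.extend Subtype.val (Subtype.val ∘ (e.symm.trans (ψ.trans e))) (fun _ => (0 : ℂ)) z) = z := by
  rw [← pic_mul e ψ⁻¹ ψ hz, inv_mul_cancel, pic_one e hz]

/-- Picture of the inverse is a right inverse on the ball. [cite: MochizukiAbsTopIII2015, Proposition 2.2 (ii) p.52] -/
theorem pic_apply_inv (e : Y ≃ₜ unitDiscOpens) (ψ : Y ≃ₜ Y) {z : ℂ} (hz : z ∈ ball (0 : ℂ) 1) :
    Function.extend Subtype.val (Subtype.val ∘ (e.symm.trans (ψ.trans e))) (fun _ => (0 : ℂ))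
      (Function.extend Subtype.val (Subtype.val ∘ (e.symm.trans (ψ⁻¹.trans e))) (fun _ => (0 : ℂ)) z) = z := by
  have := pic_inv_apply e ψ⁻¹ hz
  rwa [inv_inv] at this

/-- Picture of a power is the iterate of the picture, on the ball.
[cite: MochizukiAbsTopIII2015, Proposition 2.2 (ii) p.52] -/
theorem pic_pow (e : Y ≃ₜ unitDiscOpens) (ψ : Y ≃ₜ Y) (n : ℕ) {z : ℂ} (hz : z ∈ ball (0 : ℂ) 1) :
    Function.extend Subtype.val (Subtype.val ∘ (e.symm.trans ((ψ ^ n).trans e))) (fun _ => (0 : ℂ)) z =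
      (Function.extend Subtype.val (Subtype.val ∘ (e.symm.trans (ψ.trans e))) (fun _ => (0 : ℂ)))^[n] z := by
  induction n generalizing z with
  | zero => rw [pow_zero, Function.iterate_zero, id, pic_one e hz]
  | succ n ih =>
    rw [pow_succ, pic_mul e _ _ hz, Function.iterate_succ_apply, ih (mapsTo_extend _ hz)]

/-- **Pictures determine the homeomorphism.** [cite: MochizukiAbsTopIII2015, Proposition 2.2 (ii) p.52] -/
theorem eq_of_pic_eqOn (e : Y ≃ₜ unitDiscOpens) {ψ₁ ψ₂ : Y ≃ₜ Y}
    (h : EqOn (Function.extend Subtype.val (Subtype.val ∘ (e.symm.trans (ψ₁.trans e))) (fun _ => (0 : ℂ)))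
      (Function.extend Subtype.val (Subtype.val ∘ (e.symm.trans (ψ₂.trans e))) (fun _ => (0 : ℂ)))
      (ball 0 1)) : ψ₁ = ψ₂ := by
  ext y
  have hx := h (e y).2
  rw [pic_apply, pic_apply, e.symm_apply_apply] at hx
  exact e.injective (Subtype.ext hx)

end PictureAlgebra

/-! ### Pictures: holomorphy -/

section PictureHol

variable {Y : Type u} [TopologicalSpace Y] [ChartedSpace ℂ Y]

/-- **Biholomorphic self-homeomorphisms have automorphism pictures.**
[cite: MochizukiAbsTopIII2015, Proposition 2.2 (ii) p.52] -/
theorem isDiscAut_pic (e : Y ≃ₜ unitDiscOpens) (he : MDifferentiable 𝓘(ℂ, ℂ) 𝓘(ℂ, ℂ) e)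
    (hes : MDifferentiable 𝓘(ℂ, ℂ) 𝓘(ℂ, ℂ) e.symm) {ψ : Y ≃ₜ Y}
    (hψ : MDifferentiable 𝓘(ℂ, ℂ) 𝓘(ℂ, ℂ) ψ) (hψs : MDifferentiable 𝓘(ℂ, ℂ) 𝓘(ℂ, ℂ) ψ.symm) :
    IsDiscAut (Function.extend Subtype.val (Subtype.val ∘ (e.symm.trans (ψ.trans e))) fun _ => (0 : ℂ)) := by
  have hS : MDifferentiable 𝓘(ℂ, ℂ) 𝓘(ℂ, ℂ) (e.symm.trans (ψ.trans e)) := he.comp (hψ.comp hes)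
  have hS' : MDifferentiable 𝓘(ℂ, ℂ) 𝓘(ℂ, ℂ) (e.symm.trans (ψ⁻¹.trans e)) := he.comp (hψs.comp hes)
  exact IsDiscAut.mk' (differentiableOn_extend_of_mdifferentiable hS) (mapsTo_extend _)
    (differentiableOn_extend_of_mdifferentiable hS') (mapsTo_extend _)
    (fun z hz => pic_inv_apply e ψ hz) fun z hz => pic_apply_inv e ψ hz

/-- **Möbius pictures come from biholomorphic self-homeomorphisms.**
[cite: MochizukiAbsTopIII2015, Proposition 2.2 (ii) p.52] -/
theorem mdifferentiable_of_pic_eqOn_discRot (e : Y ≃ₜ unitDiscOpens)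
    (he : MDifferentiable 𝓘(ℂ, ℂ) 𝓘(ℂ, ℂ) e) (hes : MDifferentiable 𝓘(ℂ, ℂ) 𝓘(ℂ, ℂ) e.symm)
    {ψ : Y ≃ₜ Y} {c a : ℂ} (hc : ‖c‖ = 1) (ha : ‖a‖ < 1)
    (h : EqOn (Function.extend Subtype.val (Subtype.val ∘ (e.symm.trans (ψ.trans e))) fun _ => (0 : ℂ))
      (discRot c a) (ball 0 1)) :
    MDifferentiable 𝓘(ℂ, ℂ) 𝓘(ℂ, ℂ) ψ ∧ MDifferentiable 𝓘(ℂ, ℂ) 𝓘(ℂ, ℂ) ψ.symm := by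
  have hf := isDiscAut_discRot hc ha
  obtain ⟨g, hgd, hgm, hgf, hfg⟩ := hf.exists_inverse
  have hH : MDifferentiable 𝓘(ℂ, ℂ) 𝓘(ℂ, ℂ) (e.symm.trans (ψ.trans e)) :=
    mdifferentiable_of_differentiableOn hf.differentiableOn fun x => by
      have hx := h x.2
      rw [pic_apply] at hx
      exact hx
  -- the inverse picture agrees with `g`
  have hH' : MDifferentiable 𝓘(ℂ, ℂ) 𝓘(ℂ, ℂ) (e.symm.trans (ψ⁻¹.trans e)) := by
    refine mdifferentiable_of_differentiableOn hgd fun x => ?_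
    have hx' : Function.extend Subtype.val (Subtype.val ∘ (e.symm.trans (ψ⁻¹.trans e))) (fun _ => (0 : ℂ)) x
        ∈ ball (0 : ℂ) 1 := mapsTo_extend _ x.2
    have e1 := pic_apply_inv e ψ x.2
    have e2 : Function.extend Subtype.val (Subtype.val ∘ (e.symm.trans (ψ⁻¹.trans e))) (fun _ => (0 : ℂ)) x
        = g x := by
      conv_rhs => rw [← e1]
      rw [h hx', hgf _ hx']
    rw [pic_apply] at e2
    exact e2
  have h1 : (⇑ψ) = ⇑e.symm ∘ ⇑(e.symm.trans (ψ.trans e)) ∘ ⇑e := funext fun y => by simp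
  have h2 : (⇑ψ.symm) = ⇑e.symm ∘ ⇑(e.symm.trans (ψ⁻¹.trans e)) ∘ ⇑e := funext fun y => by
    simp only [comp_apply, Homeomorph.trans_apply, Homeomorph.symm_apply_apply]
    rfl
  refine ⟨?_, ?_⟩
  · rw [h1]; exact hes.comp (hH.comp he)
  · rw [h2]; exact hes.comp (hH'.comp he)

/-- **Realisation**: every holomorphic automorphism of the disc is the picture of a biholomorphic
self-homeomorphism of `Y`. [cite: MochizukiAbsTopIII2015, Proposition 2.2 (ii) p.52] -/
theorem exists_homeomorph_of_isDiscAut (e : Y ≃ₜ unitDiscOpens)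
    (he : MDifferentiable 𝓘(ℂ, ℂ) 𝓘(ℂ, ℂ) e) (hes : MDifferentiable 𝓘(ℂ, ℂ) 𝓘(ℂ, ℂ) e.symm)
    {f : ℂ → ℂ} (hf : IsDiscAut f) :
    ∃ ρ : Y ≃ₜ Y, MDifferentiable 𝓘(ℂ, ℂ) 𝓘(ℂ, ℂ) ρ ∧ MDifferentiable 𝓘(ℂ, ℂ) 𝓘(ℂ, ℂ) ρ.symm ∧
      EqOn (Function.extend Subtype.val (Subtype.val ∘ (e.symm.trans (ρ.trans e))) fun _ => (0 : ℂ))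
        f (ball 0 1) := by
  obtain ⟨T, g, hg, hTf, hTg, hgf, hfg, hTd, hTsd⟩ := exists_homeomorph_unitDiscOpens_of_isDiscAut hf
  refine ⟨e.trans (T.trans e.symm), hes.comp (hTd.comp he), hes.comp (hTsd.comp he), fun z hz => ?_⟩
  rw [pic_apply_of_mem e _ hz]
  simp [hTf]

end PictureHol

end Literature.AnabelianGeometry.AbsoluteAnabelian
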